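import Literature.AnabelianGeometry.EtaleTheta.Discharge.Sec3Cor38SubPredicatesAtTateTower

/-!
# [EtTh] Remark 3.6.3, the base-field-theoretic pre-step criterion of Cor. 3.8's proof, and «`Ψ` preserves the base-field-theoretic pre-steps» AT THE RANK-ONE-POINT MODELS OF RECORD

S. Mochizuki, *The étale theta function and its Frobenioid-theoretic manifestations*, Publ. RIMS **45** (2009): Rmk. 3.6.3 p. 78
(the essential image of `C^{bs-fld} → C` and its full faithfulness), Cor. 3.8 proof p. 81 l.9–15 ("a pre-step … is base-field-theoretic
if and only if … [the criterion] … Thus, `Ψ` preserves the base-field-theoretic pre-steps") [cite: MochizukiEtTh2009, Cor 3.8 p.81].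

abc-iut cell, D-0079 ORIGINAL-L / L-F [EtTh] (FACT rows F-0581 `Remark363`, F-2807 `BsFldPreStepLimitCriterion`, F-2816
`PreservesBsFldPreSteps`; cone node `EtTh:Cor3.8(ii)`), seat abc-iut-w6-d053 (gen 5), second companion of the census `LF-ETTH-S3.tsv`.
PROOF-ONLY (0 definitions, no instance, no new `Prop`): the three remaining inputs of abc-iut-w6-d040's weak Cor. 3.8 (ii) knit
`Cor38Hyp.cor38_ii_weak_of_criteria` are THEOREMS at abc-iut-w6-d048's rank-one-point tempered Frobenioids
`TemperedFrobenioid.ofRankOnePoint hZ P hpf R S` (hence at `TateTowerFrd.temperedFrobenioid` and `OneCompFrd`), assembled BY NAME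
exactly as inside abc-iut-L2-d2's `cor38_ii_weak_of_coord` (`Discharge/Sec3Cor38iiWeak.lean`) from abc-iut-w5-d135's
`remark363_of_isSharp`, the w5-d124 lineage's `bsFldPreStepLimitCriterion_of_coordWeak`, and the rank-one-point laws
`hP34Λ_ofGaloisActionConnected_weak`, `hFinv_ofGaloisActionConnected_weak`, `exists_cnstFn_effective_ofRankOnePoint`, `hQ_ofRankOnePoint`
(`Discharge/Sec3Cor38OfRankOnePoint.lean`); nothing landed is edited or restated — this file only NAMES the three heads
separately, as the L-F book lists them:
* `remark363_ofRankOnePoint` — **F-0581 `Remark363` with NO hypothesis** at every rank-one point;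
* `bsFldPreStepLimitCriterion_perfection_ofRankOnePoint` — **F-2807 at THE perfection, NO hypothesis**;
* `cor38Hyp_preservesBsFldPreSteps_ofRankOnePoint` — **F-2816 for every `Cor38Hyp h` between two rank-one points, NO further hypothesis**;
* the `TateTowerFrd` specialisations at the model of record.
HONEST FRAMING: instantiation certificates at semi-synthetic models of record (each over ONE point of `D₀`); the bare schemas stay
refuted as FACT-LIST records; refereed pre-IUT material; nothing here bears on [IUTchIII] Cor. 3.12; no side taken; typed ≠ proved.
-/

noncomputable section

namespace Literature.AnabelianGeometry.EtaleTheta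

open CategoryTheory Opposite Function Literature.AlgebraicGeometry.Frobenioids
  Literature.AnabelianGeometry.SemiGraphs LogDivisorModel LogDivisorModel.GaloisAction

namespace TemperedFrobenioid

section RankOne

variable {Z : LogDivisorModel.{0}} {G : Type} [Group G] {A : Z.GaloisAction G} (hZ : Z.CuspLaws) (P : RankOnePoint A)
  (hpf : ∀ Y : ((isConnectedGSet (G := G)).FullSubcategory)ᵒᵖ,
    IsPerfFactorialCof ((DivisorMonoids.ofGaloisActionConnected A hZ).Φ₀.obj Y))
  (R S : ((Discrete PUnit.{1})ᵒᵖ ⥤ CommMonCat.{0}) → Prop)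

/-- **F-0581 [EtTh] Rmk. 3.6.3 at every rank-one-point tempered Frobenioid, NO hypothesis**: abc-iut-w5-d135's `remark363_of_isSharp`
with sharpness from weak divisoriality (`objectwise_isDivisorial_weak`) and the Def. 3.3 / 3.6 (iii) laws of the rank-one data
(`hP34Λ_…`, `hFinv_…`). [cite: MochizukiEtTh2009, Rmk 3.6.3 p.78] -/
theorem remark363_ofRankOnePoint : (ofRankOnePoint hZ P hpf R S).Remark363 :=
  (ofRankOnePoint hZ P hpf R S).remark363_of_isSharp
    (fun B => ((ofRankOnePoint hZ P hpf R S).objectwise_isDivisorial_weak B).isSharp)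
    (hP34Λ_ofGaloisActionConnected_weak A hZ hpf) (hFinv_ofGaloisActionConnected_weak A hZ hpf)

/-- **F-2807 the base-field-theoretic pre-step criterion AT THE PERFECTION of a rank-one-point tempered Frobenioid, NO hypothesis**
(Cor. 3.8 proof p.81 l.9–13): `bsFldPreStepLimitCriterion_of_coordWeak` with `IsFrobenioid`, `hP34Λ`, the effective constant
(`exists_cnstFn_effective_ofRankOnePoint`) and `ℚ`-monoprimeness of the localized perfections (`hQ_ofRankOnePoint`) all THEOREMS there.
[cite: MochizukiEtTh2009, Cor 3.8 p.81] -/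
theorem bsFldPreStepLimitCriterion_perfection_ofRankOnePoint :
    (ofRankOnePoint hZ P hpf R S).BsFldPreStepLimitCriterion
      (PreFrobenioidData.perfection (isFrobenioid_ofRankOnePoint hZ P hpf R S)) :=
  (ofRankOnePoint hZ P hpf R S).bsFldPreStepLimitCriterion_of_coordWeak (isFrobenioid_ofRankOnePoint hZ P hpf R S)
    (hP34Λ_ofGaloisActionConnected_weak A hZ hpf) (exists_cnstFn_effective_ofRankOnePoint hZ P hpf R S)
    (hQ_ofRankOnePoint hZ P hpf R S)

variable {Z' : LogDivisorModel.{0}} {G' : Type} [Group G'] {A' : Z'.GaloisAction G'} (hZ' : Z'.CuspLaws)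
  (P' : RankOnePoint A')
  (hpf' : ∀ Y : ((isConnectedGSet (G := G')).FullSubcategory)ᵒᵖ,
    IsPerfFactorialCof ((DivisorMonoids.ofGaloisActionConnected A' hZ').Φ₀.obj Y))
  (R' S' : ((Discrete PUnit.{1})ᵒᵖ ⥤ CommMonCat.{0}) → Prop)
  (h : Cor38Hyp (ofRankOnePoint hZ P hpf R S) (ofRankOnePoint hZ' P' hpf' R' S'))

/-- **F-2816 «`Ψ` preserves the base-field-theoretic pre-steps» (Cor. 3.8 proof p.81 l.14–15) for EVERY `Cor38Hyp h` between two
rank-one-point tempered Frobenioids, NO further hypothesis**: abc-iut-w6-d040's `preservesBsFldPreSteps_of_isFrobenioid_of_criteria_weak`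
fed with `isFrobenioid_ofRankOnePoint`, Div-slimness of the one-object bases and the criterion above on both sides.
[cite: MochizukiEtTh2009, Cor 3.8 p.81] -/
theorem cor38Hyp_preservesBsFldPreSteps_ofRankOnePoint : h.PreservesBsFldPreSteps :=
  h.preservesBsFldPreSteps_of_isFrobenioid_of_criteria_weak (isFrobenioid_ofRankOnePoint hZ P hpf R S)
    (isFrobenioid_ofRankOnePoint hZ' P' hpf' R' S')
    ⟨isDivSlim_opsData_ofRankOnePoint hZ P hpf R S, isDivSlim_opsData_ofRankOnePoint hZ' P' hpf' R' S'⟩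
    (bsFldPreStepLimitCriterion_perfection_ofRankOnePoint hZ P hpf R S)
    (bsFldPreStepLimitCriterion_perfection_ofRankOnePoint hZ' P' hpf' R' S')

end RankOne

end TemperedFrobenioid

/-! ## At the model of record: the Tate tower -/

namespace TateTowerFrd

variable (R S R' S' : ((Discrete PUnit.{1})ᵒᵖ ⥤ CommMonCat.{0}) → Prop)

/-- F-0581 Rmk. 3.6.3 at the model of record, NO hypothesis. [cite: MochizukiEtTh2009, Rmk 3.6.3 p.78] -/
theorem remark363_temperedFrobenioid : (temperedFrobenioid R S).Remark363 :=
  TemperedFrobenioid.remark363_ofRankOnePoint _ _ _ R S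

/-- F-2807 the pre-step criterion at THE perfection of the model of record, NO hypothesis. [cite: MochizukiEtTh2009, Cor 3.8 p.81] -/
theorem bsFldPreStepLimitCriterion_perfection_temperedFrobenioid :
    (temperedFrobenioid R S).BsFldPreStepLimitCriterion
      (PreFrobenioidData.perfection (TemperedFrobenioid.isFrobenioid_ofRankOnePoint TateTower.cuspLaws rankOnePoint hpf R S)) :=
  TemperedFrobenioid.bsFldPreStepLimitCriterion_perfection_ofRankOnePoint _ _ _ R S

/-- F-2816 at the model of record for every `h`, NO further hypothesis. [cite: MochizukiEtTh2009, Cor 3.8 p.81] -/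
theorem cor38Hyp_preservesBsFldPreSteps_temperedFrobenioid (h : Cor38Hyp (temperedFrobenioid R S) (temperedFrobenioid R' S')) :
    h.PreservesBsFldPreSteps :=
  TemperedFrobenioid.cor38Hyp_preservesBsFldPreSteps_ofRankOnePoint _ _ _ R S _ _ _ R' S' h

end TateTowerFrd

end Literature.AnabelianGeometry.EtaleTheta

end
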